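import Literature.Analysis.FluidPDE.DeRosaGluingStageReduction
import Literature.Analysis.FluidPDE.FracNSPotentialStability
import HarnessLib

/-!
# De Rosa's gluing stage, §5.2: Prop. 5.4 in the currency of the scheme (`BDSV.PotentialBounds`)

L. De Rosa, *Infinitely many Leray–Hopf solutions for the fractional Navier–Stokes equations*,
Comm. PDE 44 (2019) 335–365 = arXiv:1801.10235, §5.2, Prop. 5.4: "For `0 ≤ t - tᵢ ≤ 2τ_q`, `N ≥ 0`,
(5.23) `‖z̃ᵢ‖_{N+α} ≲ τ_qδ_{q+1}ℓ^{-N+α}`, (5.24) `‖zᵢ - zᵢ₊₁‖_{N+α} ≲ τ_qδ_{q+1}ℓ^{-N+α}`,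
(5.25′) `‖(∂ₜ + v_ℓ·∇ + ν(-Δ)^γ)z̃ᵢ‖_{N+α} ≲ δ_{q+1}ℓ^{-N+α}`, (5.25)
`‖(∂ₜ + v_ℓ·∇)(zᵢ - zᵢ₊₁)‖_{N+α} ≲ δ_{q+1}ℓ^{-N+α}`", with `zᵢ = ℬvᵢ`, `z̃ᵢ = ℬ(vᵢ - v_ℓ)`,
"`zᵢ - zᵢ₊₁ = z̃ᵢ - z̃ᵢ₊₁`", and (5.25) from (5.25′) as (5.12) from (5.12′): "By Theorem 7.1 and
(5.23), `ν‖(-Δ)^γ z̃ᵢ‖_{N+α} ≲ ‖z̃ᵢ‖_{N+2γ+2α} …`" with the threshold (5.34) `τ_qℓ^{-2γ-2α} ≤ 1`.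

This file converts the dimensionless Prop. 5.4 (`DeRosa.fracPotentialStability`,
`FracNSPotentialStability.lean`) into the currency of the scheme:

* `DeRosa.timeDerivWithin_Icc_subset` — the one-sided time derivative of a jointly smooth field
  within a subinterval is that within the interval;
* `DeRosa.potential_lifespan` — **(5.23) and (5.25) for one exact solution on its life span**
  `S_j = [jτ_q - τ_q, jτ_q + τ_q] ∩ [0,T]` anchored to `v_ℓ` at the left endpoint: for `t ∈ S_j`,
  `N ≤ N̄`, `‖z̃(t)‖_{N+α} ≤ C τ_q δ_{q+1} ℓ^{-N+α}` and
  `‖(∂ₜ|_{S_j} + v_ℓ·∇)z̃(t)‖_{N+α} ≤ C δ_{q+1} ℓ^{-N+α}`;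
* `DeRosa.potentialBounds_of_exact` — **`BDSV.PotentialBounds` for two consecutive exact solutions**
  ((5.24)–(5.25) on `S_i ∩ S_{i+1}`): for `0 < γ < β < 1/3`, `1 < b < (1-β)/(2β)`, `α < α₀`,
  `a ≥ a₀`, `ν ∈ (0,1)`.

With `DeRosa.gluingStage_of_localExistence_of_potentialBounds_of_commutatorCZBound`
(`DeRosaGluingStageReduction.lean`) this removes the Prop. 5.4 input: `DeRosa.gluingStage` follows
from the local existence theory of the fractional Navier–Stokes equations and
`BDSV.commutatorCZBound` (`DeRosa.gluingStage_of_localExistence_of_commutatorCZBound`; the variant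
`DeRosa.gluingStage_of_localExistence₀_of_commutatorCZBound` asks for local existence from the
initial time `0` only, by the time-translation invariance `Torus.IsFracNSReynoldsOn.timeTranslate`).

## References

* L. De Rosa, Comm. PDE 44 (2019) = arXiv:1801.10235, §5.2 Prop. 5.4 ((5.23)–(5.25′)) and its
  proof, (5.34). [`Derosa2018`]
* T. Buckmaster, C. De Lellis, L. Székelyhidi Jr., V. Vicol, CPAM 72 (2019) = arXiv:1701.08678,
  Prop. 3.4 (3.7)–(3.8), §4. [`BuckmasterEtAl2018`]
-/

noncomputable section

open MeasureTheory Set Filter Topology Function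
open scoped NNReal ENNReal ContDiff

namespace Literature.Analysis.FluidPDE

namespace DeRosa

open FunctionSpaces FunctionSpaces.Torus
open BDSV hiding IsGlueFamily

/-- **The one-sided time derivative within a subinterval**: for a jointly smooth field on `[a,b]`
and `[a₂,b₂] ⊆ [a,b]` with `a₂ < b₂`, `∂ₜ|_{[a₂,b₂]} u = ∂ₜ|_{[a,b]} u` on `[a₂,b₂]`.  DUPLICATE
(dedup-00652): the `d = Fin 3` case of the tree's `BDSV.timeDerivWithin_Icc_of_subset`
(`OnsagerBDSVTransportHigher.lean`, arguments `hlt hsub hu ht x`); kept only as a deprecated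
name. [folklore] -/
@[deprecated BDSV.timeDerivWithin_Icc_of_subset (since := "2026-08-15")]
theorem timeDerivWithin_Icc_subset {F : Type} [NormedAddCommGroup F] [NormedSpace ℝ F]
    {a b a₂ b₂ : ℝ} {u : ℝ → UnitAddTorus (Fin 3) → F} (hsub : Icc a₂ b₂ ⊆ Icc a b) (hlt : a₂ < b₂)
    (hu : FunctionSpaces.Torus.IsSmoothSpaceTimeOn (Icc a b) u) {t : ℝ} (ht : t ∈ Icc a₂ b₂)
    (x : UnitAddTorus (Fin 3)) :
    FunctionSpaces.Torus.timeDerivWithin (Icc a₂ b₂) u t x =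
      FunctionSpaces.Torus.timeDerivWithin (Icc a b) u t x :=
  BDSV.timeDerivWithin_Icc_of_subset hlt hsub hu ht x

/-- `ofReal a + ofReal a = ofReal (2a)` for every real `a` (both sides vanish for `a ≤ 0`). [folklore] -/
theorem ofReal_add_self_eq (x : ℝ) : ENNReal.ofReal x + ENNReal.ofReal x = ENNReal.ofReal (2 * x) := by
  rcases le_or_gt 0 x with h | h
  · rw [two_mul, ENNReal.ofReal_add h h]
  · rw [ENNReal.ofReal_of_nonpos h.le, ENNReal.ofReal_of_nonpos (by linarith), add_zero]

/-! ## Prop. 5.4 for one exact solution on its life span -/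

section Lifespan

set_option maxHeartbeats 800000 in
/-- **De Rosa Prop. 5.4, (5.23) and (5.25), for one exact solution in the currency of the scheme**
(from the dimensionless `DeRosa.fracPotentialStability`, Prop. 3.5 = `DeRosa.fracNSApriori` for the
bounds of the exact solution, Thm. 7.1 = `Torus.exists_eContDiffHolderNorm_fracLaplacian_le` and
the thresholds (5.8), (5.34) to pass from (5.25′) to (5.25)): for `0 < γ < β < 1/3` and
`1 < b < (1-β)/(2β)` there is `α₀ > 0` such that for `0 < α < α₀`, every `N̄` and input constants
`(C_N)` there are `C` and `a₀ > 1` such that for `a ≥ a₀`, `ν ∈ [0,1]`, `T > 0`, `q`, every smooth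
solution `(v_ℓ, p_ℓ, R̊_ℓ)` of the fractional NSR system on `[0,T]` with (5.6)–(5.7′), every `j`
with `jτ_q ≤ T` and every smooth exact solution `(u, p)` of (5.9) on `S_j` with `u = v_ℓ` at the
left endpoint of `S_j`: for `t ∈ S_j` and `N ≤ N̄`, with `z̃ = ℬ(u - v_ℓ)`,
`‖z̃(t)‖_{N+α} ≤ C τ_q δ_{q+1} ℓ^{-N+α}` and `‖(∂ₜ|_{S_j} + v_ℓ·∇)z̃(t)‖_{N+α} ≤ C δ_{q+1} ℓ^{-N+α}`.
[cite: Derosa2018, §5.2 Prop. 5.4 (5.23), (5.25), (5.34)] -/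
theorem potential_lifespan :
    ∀ β : ℝ, 0 < β → β < 1 / 3 → ∀ γ : ℝ, 0 < γ → γ < β →
      ∀ b : ℝ, 1 < b → b < (1 - β) / (2 * β) →
        ∃ α₀ : ℝ, 0 < α₀ ∧ ∀ α : ℝ, 0 < α → α < α₀ → ∀ (Nbar : ℕ) (Cin : ℕ → ℝ),
          ∃ (C a₀ : ℝ), 1 < a₀ ∧ ∀ a : ℝ, a₀ ≤ a → ∀ ν : ℝ, 0 ≤ ν → ν ≤ 1 → ∀ T : ℝ, 0 < T →
            ∀ (q : ℕ) (vℓ : ℝ → UnitAddTorus (Fin 3) → EuclideanSpace ℝ (Fin 3))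
              (pℓ : ℝ → UnitAddTorus (Fin 3) → ℝ) (Rℓ : ℝ → UnitAddTorus (Fin 3) → Fin 3 → EuclideanSpace ℝ (Fin 3)),
              Torus.IsFracNSReynoldsOn (Icc 0 T) γ ν vℓ pℓ Rℓ →
              (∀ N : ℕ, HolderSupLE T vℓ (N + 1) 0
                (Cin N * (Real.sqrt (amp β a b q) * freq a b q * mollScale β α a b q ^ (-(N : ℝ))))) →
              (∀ N : ℕ, HolderSupLE T Rℓ N (Real.toNNReal α)
                (Cin N * (amp β a b (q + 1) * mollScale β α a b q ^ (-(N : ℝ) + α)))) →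
              ∀ (i : ℕ) (v : ℝ → UnitAddTorus (Fin 3) → EuclideanSpace ℝ (Fin 3)) (p : ℝ → UnitAddTorus (Fin 3) → ℝ),
                (i : ℝ) * glueScale β α a b q ≤ T →
                Torus.IsFracNSReynoldsOn (glueInterval T (glueScale β α a b q) i) γ ν v p (fun _ _ _ => 0) →
                v (max ((i : ℝ) * glueScale β α a b q - glueScale β α a b q) 0) =
                  vℓ (max ((i : ℝ) * glueScale β α a b q - glueScale β α a b q) 0) →
                ∀ N : ℕ, N ≤ Nbar → ∀ t ∈ glueInterval T (glueScale β α a b q) i,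
                  Torus.eContDiffHolderNorm N (Real.toNNReal α) (BDSV.biotSavart (fun y => v t y - vℓ t y)) ≤
                    ENNReal.ofReal (C * (glueScale β α a b q * amp β a b (q + 1) * mollScale β α a b q ^ (-(N : ℝ) + α))) ∧
                  Torus.eContDiffHolderNorm N (Real.toNNReal α)
                    (advectiveDerivWithin (glueInterval T (glueScale β α a b q) i) vℓ
                      (fun t x => BDSV.biotSavart (fun y => v t y - vℓ t y) x) t) ≤
                    ENNReal.ofReal (C * (amp β a b (q + 1) * mollScale β α a b q ^ (-(N : ℝ) + α))) := by
  intro β hβ hβ3 γ hγ hγβ b hb hb'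
  have hβ1 : β < 1 := by linarith
  have hγ3 : γ < 1 / 3 := by linarith
  have hb1 : 1 ≤ b := hb.le
  have hβ0 : 0 ≤ β := hβ.le
  -- the threshold on `α`: `2γ + 2α ≤ 1`, `α < 1`, and `3αγ ≤ (1-β)(1-3γ)` for (5.34)
  set α₀ : ℝ := min (1 / 2) (min ((1 - 2 * γ) / 2) ((1 - β) * (1 - 3 * γ) / (3 * γ))) with hα₀
  have hα₀pos : 0 < α₀ := by
    refine lt_min (by norm_num) (lt_min (by linarith) ?_)
    exact div_pos (mul_pos (by linarith) (by linarith)) (by linarith)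
  refine ⟨α₀, hα₀pos, fun α hα hαlt Nbar Cin => ?_⟩
  have hα12 : α < 1 / 2 := lt_of_lt_of_le hαlt (min_le_left _ _)
  have hα1 : α < 1 := by linarith
  have hαs : 2 * γ + 2 * α ≤ 1 := by
    have := lt_of_lt_of_le hαlt ((min_le_right _ _).trans (min_le_left _ _)); linarith
  have hαγ : 3 * α * γ ≤ (1 - β) * (1 - 3 * γ) := by
    have h := lt_of_lt_of_le hαlt ((min_le_right _ _).trans (min_le_right _ _))
    have h3γ : 0 < 3 * γ := by linarith
    have := (lt_div_iff₀ h3γ).1 h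
    linarith
  set α' : ℝ≥0 := Real.toNNReal α with hα'def
  have hα' : 0 < α' := Real.toNNReal_pos.2 hα
  have hα1' : α' < 1 := Real.toNNReal_lt_one.2 hα1
  have hαc : ((α' : ℝ≥0) : ℝ) = α := Real.coe_toNNReal α hα.le
  -- the Hölder exponent of (5.34): `s = 2γ + 2α`
  set s : ℝ≥0 := ⟨2 * γ + 2 * α, by linarith⟩ with hsdef
  have hs_coe : ((s : ℝ≥0) : ℝ) = 2 * γ + 2 * α := rfl
  have hs : 2 * γ + (α' : ℝ) < (s : ℝ) := by rw [hαc, hs_coe]; linarith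
  have hs1 : s ≤ 1 := by rw [← NNReal.coe_le_coe, hs_coe]; exact_mod_cast hαs
  -- the dimensionless constants
  obtain ⟨cA, hcA, CA, hCA1, hAp⟩ := fracNSApriori hα' hα1' (Nbar + 2)
  obtain ⟨cP, hcP, CP, hCP0, hPt⟩ := fracPotentialStability hα' hα1' (Nbar + 1)
  have h71 : ∀ N : ℕ, ∃ C : ℝ≥0, ∀ {u : UnitAddTorus (Fin 3) → EuclideanSpace ℝ (Fin 3)}, IsSmooth u →
      Torus.eContDiffHolderNorm N α' (Torus.fracLaplacian γ u) ≤ C * Torus.eContDiffHolderNorm N s u :=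
    fun N => Torus.exists_eContDiffHolderNorm_fracLaplacian_le (Fin 3) hγ (by linarith) hs hs1 N
  choose C71 hC71 using h71
  -- the input constants, made uniform
  set Kmax : ℝ := ∑ m ∈ Finset.range (Nbar + 2), (((m : ℝ) + 4) * |Cin m| + |Cin (m + 1)|) with hKmax
  have hKmax0 : 0 ≤ Kmax := Finset.sum_nonneg fun _ _ => by positivity
  have hKm : ∀ m : ℕ, m ≤ Nbar + 1 → ((m : ℝ) + 4) * |Cin m| + |Cin (m + 1)| ≤ Kmax := fun m hm =>
    Finset.single_le_sum (f := fun m : ℕ => ((m : ℝ) + 4) * |Cin m| + |Cin (m + 1)|) (fun _ _ => by positivity)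
      (Finset.mem_range.2 (by omega))
  set Emax : ℝ := ∑ m ∈ Finset.range (Nbar + 3), |Cin m| with hEmax
  have hEmax0 : 0 ≤ Emax := Finset.sum_nonneg fun _ _ => abs_nonneg _
  have hEm : ∀ m : ℕ, m ≤ Nbar + 2 → |Cin m| ≤ Emax := fun m hm =>
    Finset.single_le_sum (f := fun m : ℕ => |Cin m|) (fun _ _ => abs_nonneg _) (Finset.mem_range.2 (by omega))
  set S71 : ℝ := ∑ N ∈ Finset.range (Nbar + 1), ((N : ℝ) + 4) * (C71 N : ℝ) with hS71
  have hS710 : 0 ≤ S71 := Finset.sum_nonneg fun _ _ => by positivity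
  have hS71N : ∀ N : ℕ, N ≤ Nbar → ((N : ℝ) + 4) * (C71 N : ℝ) ≤ S71 := fun N hN =>
    Finset.single_le_sum (f := fun N : ℕ => ((N : ℝ) + 4) * (C71 N : ℝ)) (fun _ _ => by positivity)
      (Finset.mem_range.2 (by omega))
  -- the output constant
  set C : ℝ := 2 * CP * Emax * (1 + 2 * S71) with hCdef
  -- the thresholds: CFL for Prop. 3.5 and Prop. 5.4, and (5.34)
  have hE34 : (β - 1 - 3 * α / 2) * (2 * α - (2 * γ + 2 * α)) + (β - 1) + b * (-β * (2 * α - (2 * γ + 2 * α))) < 0 := by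
    have h1 : b * β < (1 - β) / 2 := by
      have h2β : 0 < 2 * β := by linarith
      have := (lt_div_iff₀ h2β).1 hb'
      linarith
    nlinarith
  obtain ⟨a₁, ha₁, hCFL⟩ := exists_threshold_cfl (β := β) hb1 hβ0 hα (lt_min hcA hcP) (2 * (CA * (1 + Kmax)))
  obtain ⟨a₂, ha₂, hP34⟩ := exists_threshold_glueScale_rpow (β := β) (α := α) hb1 hE34 1
  refine ⟨C, max 2 (max a₁ a₂), lt_of_lt_of_le one_lt_two (le_max_left _ _),
    fun a ha ν hν0 hν1 T hT q vℓ pℓ Rℓ hNSR h213 h214 i v p hiT hex hanch N hN t ht => ?_⟩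
  have ha2 : 2 ≤ a := le_trans (le_max_left _ _) ha
  have ha1 : 1 ≤ a := by linarith
  have haa₁ : a₁ ≤ a := le_trans ((le_max_left _ _).trans (le_max_right _ _)) ha
  have haa₂ : a₂ ≤ a := le_trans ((le_max_right _ _).trans (le_max_right _ _)) ha
  -- the scales
  set τ := glueScale β α a b q with hτdef
  set ℓ := mollScale β α a b q with hℓdef
  set δ := amp β a b (q + 1) with hδdef
  set A := Real.sqrt (amp β a b q) * freq a b q with hAdef
  have hτ : 0 < τ := glueScale_pos ha1 q
  have hℓ : 0 < ℓ := mollScale_pos ha1 q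
  have hℓ1 : ℓ ≤ 1 := mollScale_le_one ha1 hb1 hβ0 hα.le q
  have hδ : 0 < δ := amp_pos ha1 (q + 1)
  have hA : 0 < A := mul_pos (Real.sqrt_pos.2 (amp_pos ha1 q)) (freq_pos ha1 q)
  have hΛ1 : 1 ≤ ℓ⁻¹ := one_le_inv_iff₀.2 ⟨hℓ, hℓ1⟩
  have hΛ0 : 0 < ℓ⁻¹ := by positivity
  -- the life span
  set a' := max ((i : ℝ) * τ - τ) 0 with ha'
  set b' := min ((i : ℝ) * τ + τ) T with hb'def
  have hS : glueInterval T τ i = Icc a' b' := glueInterval_eq_Icc T τ i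
  have hi0 : 0 ≤ (i : ℝ) * τ := by positivity
  have hab : a' < b' := by
    simp only [ha', hb'def, max_lt_iff, lt_min_iff]
    refine ⟨⟨by linarith, by linarith⟩, by linarith, hT⟩
  have hsub : Icc a' b' ⊆ Icc 0 T := by rw [← hS]; exact glueInterval_subset_Icc T τ i
  have hlen : b' - a' ≤ 2 * τ := by
    have h1 : b' ≤ (i : ℝ) * τ + τ := min_le_left _ _
    have h2 : (i : ℝ) * τ - τ ≤ a' := le_max_left _ _
    linarith
  have hlen0 : 0 ≤ b' - a' := by linarith
  have hexI : Torus.IsFracNSReynoldsOn (Icc a' b') γ ν v p (fun _ _ _ => 0) := by rwa [hS] at hex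
  have hℓI : Torus.IsFracNSReynoldsOn (Icc a' b') γ ν vℓ pℓ Rℓ := hNSR.mono hsub (uniqueDiffOn_Icc hab)
  have hanch' : v a' = vℓ a' := hanch
  rw [hS] at ht
  -- the dimensionless data: `U = (1 + K) A ℓ^{-α}`, `Λ = ℓ⁻¹`, `E = E_max δ ℓ^α`
  set U : ℝ := (1 + Kmax) * (A * ℓ ^ (-α)) with hUdef
  have hU : 0 < U := by positivity
  set E : ℝ := Emax * (δ * ℓ ^ α) with hEdef
  have hE0 : 0 ≤ E := by positivity
  -- (5.6) interpolated: `‖v_ℓ(t)‖_{m,α} ≤ U Λ^{m-1}` for `1 ≤ m ≤ N̄ + 2` on `[0,T]`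
  have hvℓ : ∀ t ∈ Icc 0 T, ∀ m : ℕ, 1 ≤ m → m ≤ Nbar + 2 →
      Torus.eContDiffHolderNorm m α' (vℓ t) ≤ ENNReal.ofReal (U * ℓ⁻¹ ^ (m - 1)) := by
    intro t ht m hm1 hm2
    obtain ⟨N, rfl⟩ : ∃ N, m = N + 1 := ⟨m - 1, by omega⟩
    have key := eContDiffHolderNorm_succ_le_of_holderSupLE (Cin := Cin) hα hα1 hℓ hℓ1 hA.le
      (fun s hs => hNSR.smooth_velocity.isSmooth_slice hs) h213 ht N
    refine key.trans (ENNReal.ofReal_le_ofReal ?_)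
    rw [Nat.add_sub_cancel]
    have e : ℓ ^ (-(N : ℝ) - α) = ℓ ^ (-α) * ℓ⁻¹ ^ N := rpow_neg_natCast_sub hℓ α N
    rw [e]
    calc (((N : ℝ) + 4) * |Cin N| + |Cin (N + 1)|) * (A * (ℓ ^ (-α) * ℓ⁻¹ ^ N))
        ≤ Kmax * (A * (ℓ ^ (-α) * ℓ⁻¹ ^ N)) := mul_le_mul_of_nonneg_right (hKm N (by omega)) (by positivity)
      _ ≤ (1 + Kmax) * (A * (ℓ ^ (-α) * ℓ⁻¹ ^ N)) :=
          mul_le_mul_of_nonneg_right (le_add_of_nonneg_left zero_le_one) (by positivity)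
      _ = U * ℓ⁻¹ ^ N := by rw [hUdef]; ring
  -- (5.7′): `‖R̊_ℓ(t)‖_{m,α} ≤ E Λ^m` for `m ≤ N̄ + 2`
  have hRℓ : ∀ t ∈ Icc 0 T, ∀ m : ℕ, m ≤ Nbar + 2 →
      Torus.eContDiffHolderNorm m α' (Rℓ t) ≤ ENNReal.ofReal (E * ℓ⁻¹ ^ m) := by
    intro t ht m hm
    refine (h214 m t ht).trans (ENNReal.ofReal_le_ofReal ?_)
    have e : ℓ ^ (-(m : ℝ) + α) = ℓ ^ α * ℓ⁻¹ ^ m := rpow_neg_natCast_add hℓ α m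
    rw [e]
    calc Cin m * (δ * (ℓ ^ α * ℓ⁻¹ ^ m)) ≤ |Cin m| * (δ * (ℓ ^ α * ℓ⁻¹ ^ m)) :=
          mul_le_mul_of_nonneg_right (le_abs_self _) (by positivity)
      _ ≤ Emax * (δ * (ℓ ^ α * ℓ⁻¹ ^ m)) := mul_le_mul_of_nonneg_right (hEm m hm) (by positivity)
      _ = E * ℓ⁻¹ ^ m := by rw [hEdef]; ring
  -- the CFL conditions `(b' - a') U ≤ c_A`, `(b' - a') (C_A U) ≤ c_P`
  have hcfl : 2 * τ * (CA * U) ≤ min cA cP := by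
    have e : 2 * τ * (CA * U) = 2 * (CA * (1 + Kmax)) * ℓ ^ α := by
      have h1 := glueScale_mul_cflBound (β := β) (α := α) (b := b) ha1 q (1 + Kmax)
      calc 2 * τ * (CA * U) = 2 * CA * (τ * ((1 + Kmax) * (A * ℓ ^ (-α)))) := by rw [hUdef]; ring
        _ = 2 * CA * ((1 + Kmax) * ℓ ^ α) := by rw [hτdef, hAdef, hℓdef, h1]
        _ = 2 * (CA * (1 + Kmax)) * ℓ ^ α := by ring
    rw [e]
    exact hCFL a haa₁ q
  have hcflA : (b' - a') * U ≤ cA := by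
    have h1 : (b' - a') * U ≤ 2 * τ * U := mul_le_mul_of_nonneg_right hlen hU.le
    have h2 : 2 * τ * U ≤ 2 * τ * (CA * U) := by
      have : U ≤ CA * U := le_mul_of_one_le_left hU.le hCA1
      exact mul_le_mul_of_nonneg_left this (by positivity)
    exact h1.trans (h2.trans ((hcfl.trans (min_le_left _ _))))
  have hcflP : (b' - a') * (CA * U) ≤ cP :=
    ((mul_le_mul_of_nonneg_right hlen (by positivity)).trans hcfl).trans (min_le_right _ _)
  -- Prop. 3.5: `‖u(t)‖_{m,α} ≤ C_A U Λ^{m-1}` for `1 ≤ m ≤ N̄ + 2` on the life span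
  have hdat : ∀ m : ℕ, 1 ≤ m → m ≤ Nbar + 2 → Torus.eContDiffHolderNorm m α' (v a') ≤ ENNReal.ofReal (U * ℓ⁻¹ ^ (m - 1)) := by
    intro m hm1 hm2
    rw [hanch']
    exact hvℓ a' (hsub ⟨le_rfl, hab.le⟩) m hm1 hm2
  have hv : ∀ t ∈ Icc a' b', ∀ m : ℕ, 1 ≤ m → m ≤ Nbar + 2 →
      Torus.eContDiffHolderNorm m α' (v t) ≤ ENNReal.ofReal (CA * U * ℓ⁻¹ ^ (m - 1)) :=
    hAp hab hν0 hγ (by linarith) hexI hU hΛ1 hdat hcflA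
  -- Prop. 5.4 with `U' = C_A U`
  have hCAU : 0 < CA * U := by positivity
  have hvℓ' : ∀ t ∈ Icc a' b', ∀ m : ℕ, 1 ≤ m → m ≤ Nbar + 1 + 1 →
      Torus.eContDiffHolderNorm m α' (vℓ t) ≤ ENNReal.ofReal (CA * U * ℓ⁻¹ ^ (m - 1)) := by
    intro t ht m hm1 hm2
    have h0 : 0 ≤ U * ℓ⁻¹ ^ (m - 1) := by positivity
    have key : U * ℓ⁻¹ ^ (m - 1) ≤ CA * U * ℓ⁻¹ ^ (m - 1) :=
      calc U * ℓ⁻¹ ^ (m - 1) = 1 * (U * ℓ⁻¹ ^ (m - 1)) := (one_mul _).symm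
        _ ≤ CA * (U * ℓ⁻¹ ^ (m - 1)) := mul_le_mul_of_nonneg_right hCA1 h0
        _ = CA * U * ℓ⁻¹ ^ (m - 1) := (mul_assoc _ _ _).symm
    exact (hvℓ t (hsub ht) m hm1 (by omega)).trans (ENNReal.ofReal_le_ofReal key)
  have hv' : ∀ t ∈ Icc a' b', ∀ m : ℕ, 1 ≤ m → m ≤ Nbar + 1 + 1 →
      Torus.eContDiffHolderNorm m α' (v t) ≤ ENNReal.ofReal (CA * U * ℓ⁻¹ ^ (m - 1)) :=
    fun t ht m hm1 hm2 => hv t ht m hm1 (by omega)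
  have hR' : ∀ t ∈ Icc a' b', ∀ m : ℕ, m ≤ Nbar + 1 →
      Torus.eContDiffHolderNorm m α' (Rℓ t) ≤ ENNReal.ofReal (E * ℓ⁻¹ ^ m) :=
    fun t ht m hm => hRℓ t (hsub ht) m (by omega)
  have hpot := hPt hab hν0 hγ (by linarith) hℓI hexI hanch' hCAU hΛ1 hE0 hvℓ' hv' hR' hcflP
  -- `hpot : ∀ s ∈ [a',b'], ∀ N ≤ N̄+1, (5.23) ∧ (5.25′)` with constants `C_P (b'-a') E Λ^N`, `C_P E Λ^N`
  -- conversions of the right-hand sides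
  have hconv23 : ∀ N : ℕ, CP * (b' - a') * E * ℓ⁻¹ ^ N ≤ 2 * CP * Emax * (τ * δ * ℓ ^ (-(N : ℝ) + α)) := by
    intro N
    have e : τ * δ * ℓ ^ (-(N : ℝ) + α) = τ * (δ * ℓ ^ α) * ℓ⁻¹ ^ N := by
      rw [rpow_neg_natCast_add hℓ α N]; ring
    rw [e]
    calc CP * (b' - a') * E * ℓ⁻¹ ^ N ≤ CP * (2 * τ) * E * ℓ⁻¹ ^ N :=
          mul_le_mul_of_nonneg_right (mul_le_mul_of_nonneg_right (mul_le_mul_of_nonneg_left hlen hCP0) hE0)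
            (by positivity)
      _ = 2 * CP * Emax * (τ * (δ * ℓ ^ α) * ℓ⁻¹ ^ N) := by rw [hEdef]; ring
  have hconv25 : ∀ N : ℕ, CP * E * ℓ⁻¹ ^ N = CP * Emax * (δ * ℓ ^ (-(N : ℝ) + α)) := by
    intro N
    rw [rpow_neg_natCast_add hℓ α N, hEdef]; ring
  have hCPE : 0 ≤ CP * Emax := mul_nonneg hCP0 hEmax0
  have hCge23 : 2 * CP * Emax ≤ C := by
    have key : C - 2 * CP * Emax = 4 * S71 * (CP * Emax) := by rw [hCdef]; ring
    have h4 : 0 ≤ 4 * S71 * (CP * Emax) := by positivity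
    linarith only [key, h4]
  refine ⟨?_, ?_⟩
  · -- (5.23)
    refine ((hpot t ht N (by omega)).1).trans (ENNReal.ofReal_le_ofReal ?_)
    refine (hconv23 N).trans ?_
    exact mul_le_mul_of_nonneg_right hCge23 (by positivity)
  · -- (5.25) from (5.25′) and (5.34)
    rw [hS]
    set z : ℝ → UnitAddTorus (Fin 3) → EuclideanSpace ℝ (Fin 3) := fun r y => BDSV.biotSavart (fun w => v r w - vℓ r w) y with hzdef
    have hzdef' : ∀ r, z r = BDSV.biotSavart (fun y => v r y - vℓ r y) := fun r => rfl
    have hzst : FunctionSpaces.Torus.IsSmoothSpaceTimeOn (Icc a' b') z := fracPotential_smooth_Z' hab hℓI hexI hzdef'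
    have hzs : ∀ r ∈ Icc a' b', IsSmooth (z r) := fun r hr => hzst.isSmooth_slice hr
    have hvℓt : IsSmooth (vℓ t) := hℓI.smooth_velocity.isSmooth_slice ht
    -- the two levels of (5.23) as sup bounds on the derivatives
    obtain ⟨h23N, hL⟩ := hpot t ht N (by omega)
    obtain ⟨h23N1, -⟩ := hpot t ht (N + 1) (by omega)
    set X : ℕ → ℝ := fun k => CP * (b' - a') * E * ℓ⁻¹ ^ k with hXdef
    have hX0 : ∀ k, 0 ≤ X k := fun k => by positivity
    -- interpolation: `‖z̃‖_{N,s} ≤ (N+1) X_N + X_{N+1} ℓ^{1-s} + 2 X_N ℓ^{-s}`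
    set M : ℕ → ℝ := fun k => if k ≤ N then X N else X (N + 1) with hMdef
    have hM0 : ∀ k, 0 ≤ M k := fun k => by simp only [hMdef]; split_ifs <;> exact hX0 _
    have hg : ContDiff ℝ (N + 1) (FunctionSpaces.Torus.lift (z t)) := (hzs t ht).isContDiff (mod_cast le_top)
    have hMb : ∀ k ≤ N + 1, ∀ y : EuclideanSpace ℝ (Fin 3), ‖iteratedFDeriv ℝ k (FunctionSpaces.Torus.lift (z t)) y‖ ≤ M k := by
      intro k hk y
      rcases Nat.lt_or_ge k (N + 1) with hk1 | hk1
      · have hk' : k ≤ N := by omega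
        simp only [hMdef, if_pos hk']
        have := norm_iteratedFDeriv_lift_le_of_eContDiffHolderNorm_le h23N hk' y
        rwa [max_eq_left (hX0 N)] at this
      · have hk' : k = N + 1 := by omega
        subst hk'
        simp only [hMdef, show ¬ (N + 1 ≤ N) from by omega, if_false]
        have := norm_iteratedFDeriv_lift_le_of_eContDiffHolderNorm_le h23N1 le_rfl y
        rwa [max_eq_left (hX0 (N + 1))] at this
    have hinterp := FunctionSpaces.eContDiffHolderNorm_le_of_norm_iteratedFDeriv_le (k := N) hg hM0 hMb hs1 hℓ
    have hsum : (∑ k ∈ Finset.range (N + 1), M k) = ((N : ℝ) + 1) * X N := by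
      rw [Finset.sum_congr rfl fun k hk => by
        rw [show M k = X N from if_pos (Nat.lt_succ_iff.1 (Finset.mem_range.1 hk))]]
      rw [Finset.sum_const, Finset.card_range, nsmul_eq_mul]
      push_cast
      ring
    have hMN : M N = X N := by simp [hMdef]
    have hMN1 : M (N + 1) = X (N + 1) := by simp [hMdef]
    have hℓs : ℓ⁻¹ ^ (s : ℝ) = ℓ ^ (-(s : ℝ)) := by rw [Real.inv_rpow hℓ.le, Real.rpow_neg hℓ.le]
    have hzs_bound : Torus.eContDiffHolderNorm N s (z t) ≤
        ENNReal.ofReal (((N : ℝ) + 4) * (CP * (b' - a') * E * ℓ⁻¹ ^ N) * ℓ ^ (-(s : ℝ))) := by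
      refine hinterp.trans (ENNReal.ofReal_le_ofReal ?_)
      rw [hsum, hMN, hMN1, hℓs]
      -- `Λ^{N+1} ℓ^{1-s} = Λ^N ℓ^{-s}` and `Λ^N ≤ Λ^N ℓ^{-s}`
      have hℓms : 1 ≤ ℓ ^ (-(s : ℝ)) := Real.one_le_rpow_of_pos_of_le_one_of_nonpos hℓ hℓ1 (by
        have := s.coe_nonneg; linarith)
      have e1 : X (N + 1) * ℓ ^ (1 - (s : ℝ)) = X N * ℓ ^ (-(s : ℝ)) := by
        simp only [hXdef]
        have hpow : ℓ⁻¹ ^ (N + 1) * ℓ ^ (1 - (s : ℝ)) = ℓ⁻¹ ^ N * ℓ ^ (-(s : ℝ)) := by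
          rw [pow_succ, show (1 - (s : ℝ)) = 1 + -(s : ℝ) by ring, Real.rpow_add hℓ, Real.rpow_one]
          have hinv : ℓ⁻¹ * ℓ = 1 := inv_mul_cancel₀ hℓ.ne'
          calc ℓ⁻¹ ^ N * ℓ⁻¹ * (ℓ * ℓ ^ (-(s : ℝ))) = ℓ⁻¹ ^ N * (ℓ⁻¹ * ℓ) * ℓ ^ (-(s : ℝ)) := by ring
            _ = ℓ⁻¹ ^ N * ℓ ^ (-(s : ℝ)) := by rw [hinv, mul_one]
        calc CP * (b' - a') * E * ℓ⁻¹ ^ (N + 1) * ℓ ^ (1 - (s : ℝ)) = CP * (b' - a') * E * (ℓ⁻¹ ^ (N + 1) * ℓ ^ (1 - (s : ℝ))) := by ring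
          _ = CP * (b' - a') * E * (ℓ⁻¹ ^ N * ℓ ^ (-(s : ℝ))) := by rw [hpow]
          _ = CP * (b' - a') * E * ℓ⁻¹ ^ N * ℓ ^ (-(s : ℝ)) := by ring
      have e2 : ((N : ℝ) + 1) * X N ≤ ((N : ℝ) + 1) * X N * ℓ ^ (-(s : ℝ)) :=
        le_mul_of_one_le_right (by positivity) hℓms
      rw [e1]
      have key : ((N : ℝ) + 4) * (CP * (b' - a') * E * ℓ⁻¹ ^ N) * ℓ ^ (-(s : ℝ)) -
          (((N : ℝ) + 1) * X N + (X N * ℓ ^ (-(s : ℝ)) + 2 * X N * ℓ ^ (-(s : ℝ)))) =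
          ((N : ℝ) + 1) * X N * ℓ ^ (-(s : ℝ)) - ((N : ℝ) + 1) * X N := by
        simp only [hXdef]; ring
      linarith only [key, e2]
    -- Thm. 7.1: `ν‖(-Δ)^γ z̃‖_{N,α} ≤ C71 ‖z̃‖_{N,s}`
    have h71z := hC71 N (hzs t ht)
    -- (5.34): `(b' - a') ℓ^{-s} ≤ 2 τ ℓ^{-s} ≤ 2`
    have hP : (b' - a') * ℓ ^ (-(s : ℝ)) ≤ 2 := by
      have h1 := hP34 a haa₂ q
      rw [one_mul] at h1
      have h2 : (b' - a') * ℓ ^ (-(s : ℝ)) ≤ 2 * τ * ℓ ^ (-(s : ℝ)) := mul_le_mul_of_nonneg_right hlen (Real.rpow_nonneg hℓ.le _)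
      rw [← hτdef, ← hℓdef] at h1
      rw [hs_coe] at h2 ⊢
      have h3 : 2 * τ * ℓ ^ (-(2 * γ + 2 * α)) = 2 * (τ * ℓ ^ (-(2 * γ + 2 * α))) := by ring
      linarith only [h1, h2, h3]
    -- the transport derivative as `L - ν(-Δ)^γ z̃`
    have hLs : IsSmooth (fun x => FunctionSpaces.Torus.timeDerivWithin (Icc a' b') z t x +
        FunctionSpaces.Torus.convect (vℓ t) (z t) x + ν • Torus.fracLaplacian γ (z t) x) := by
      have h1 : IsSmooth (FunctionSpaces.Torus.timeDerivWithin (Icc a' b') z t) :=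
        (hzst.timeDerivWithin (uniqueDiffOn_Icc hab)).isSmooth_slice ht
      have h2 : IsSmooth (FunctionSpaces.Torus.convect (vℓ t) (z t)) := hvℓt.convect (hzs t ht)
      have h3 : IsSmooth (fun x => ν • Torus.fracLaplacian γ (z t) x) := ((hzs t ht).fracLaplacian hγ.le).smul ν
      exact (h1.add h2).add h3
    have hΛs : IsSmooth (fun x => ν • Torus.fracLaplacian γ (z t) x) := ((hzs t ht).fracLaplacian hγ.le).smul ν
    have eAdv : advectiveDerivWithin (Icc a' b') vℓ z t =
        (fun x => FunctionSpaces.Torus.timeDerivWithin (Icc a' b') z t x +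
          FunctionSpaces.Torus.convect (vℓ t) (z t) x + ν • Torus.fracLaplacian γ (z t) x) -
          fun x => ν • Torus.fracLaplacian γ (z t) x := by
      funext x
      simp [advectiveDerivWithin]
    show Torus.eContDiffHolderNorm N α' (advectiveDerivWithin (Icc a' b') vℓ z t) ≤ _
    rw [eAdv]
    have hL' : Torus.eContDiffHolderNorm N α' (fun x => FunctionSpaces.Torus.timeDerivWithin (Icc a' b') z t x +
        FunctionSpaces.Torus.convect (vℓ t) (z t) x + ν • Torus.fracLaplacian γ (z t) x) ≤ ENNReal.ofReal (CP * E * ℓ⁻¹ ^ N) := hL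
    calc Torus.eContDiffHolderNorm N α'
          ((fun x => FunctionSpaces.Torus.timeDerivWithin (Icc a' b') z t x +
            FunctionSpaces.Torus.convect (vℓ t) (z t) x + ν • Torus.fracLaplacian γ (z t) x) -
            fun x => ν • Torus.fracLaplacian γ (z t) x)
        ≤ Torus.eContDiffHolderNorm N α' (fun x => FunctionSpaces.Torus.timeDerivWithin (Icc a' b') z t x +
            FunctionSpaces.Torus.convect (vℓ t) (z t) x + ν • Torus.fracLaplacian γ (z t) x) +
            Torus.eContDiffHolderNorm N α' (fun x => ν • Torus.fracLaplacian γ (z t) x) :=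
          Torus.eContDiffHolderNorm_sub_le (hLs.isContDiff (mod_cast le_top)) (hΛs.isContDiff (mod_cast le_top))
      _ ≤ ENNReal.ofReal (CP * E * ℓ⁻¹ ^ N) +
            ‖ν‖ₑ * (C71 N * ENNReal.ofReal (((N : ℝ) + 4) * (CP * (b' - a') * E * ℓ⁻¹ ^ N) * ℓ ^ (-(s : ℝ)))) := by
          refine add_le_add hL' ?_
          rw [show (fun x => ν • Torus.fracLaplacian γ (z t) x) = ν • Torus.fracLaplacian γ (z t) from rfl,
            Torus.eContDiffHolderNorm_const_smul (((hzs t ht).fracLaplacian hγ.le).isContDiff (mod_cast le_top))]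
          exact mul_le_mul' le_rfl (h71z.trans (mul_le_mul' le_rfl hzs_bound))
      _ ≤ ENNReal.ofReal (C * (δ * ℓ ^ (-(N : ℝ) + α))) := by
          have hν : ‖ν‖ₑ ≤ 1 := by
            rw [Real.enorm_eq_ofReal hν0, ← ENNReal.ofReal_one]; exact ENNReal.ofReal_le_ofReal hν1
          have e71 : (C71 N : ℝ≥0∞) = ENNReal.ofReal (C71 N : ℝ) := (ENNReal.ofReal_coe_nnreal).symm
          calc ENNReal.ofReal (CP * E * ℓ⁻¹ ^ N) +
                ‖ν‖ₑ * (C71 N * ENNReal.ofReal (((N : ℝ) + 4) * (CP * (b' - a') * E * ℓ⁻¹ ^ N) * ℓ ^ (-(s : ℝ))))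
              ≤ ENNReal.ofReal (CP * E * ℓ⁻¹ ^ N) +
                  1 * (C71 N * ENNReal.ofReal (((N : ℝ) + 4) * (CP * (b' - a') * E * ℓ⁻¹ ^ N) * ℓ ^ (-(s : ℝ)))) := by
                gcongr
            _ = ENNReal.ofReal (CP * E * ℓ⁻¹ ^ N +
                  (C71 N : ℝ) * (((N : ℝ) + 4) * (CP * (b' - a') * E * ℓ⁻¹ ^ N) * ℓ ^ (-(s : ℝ)))) := by
                rw [one_mul, e71, ← ENNReal.ofReal_mul (C71 N).coe_nonneg, ← ENNReal.ofReal_add (by positivity) (by positivity)]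
            _ ≤ ENNReal.ofReal (C * (δ * ℓ ^ (-(N : ℝ) + α))) := by
                refine ENNReal.ofReal_le_ofReal ?_
                have hY : 0 ≤ CP * E * ℓ⁻¹ ^ N := by positivity
                have h2 : (C71 N : ℝ) * (((N : ℝ) + 4) * (CP * (b' - a') * E * ℓ⁻¹ ^ N) * ℓ ^ (-(s : ℝ))) ≤
                    2 * (((N : ℝ) + 4) * (C71 N : ℝ)) * (CP * E * ℓ⁻¹ ^ N) := by
                  have e : (C71 N : ℝ) * (((N : ℝ) + 4) * (CP * (b' - a') * E * ℓ⁻¹ ^ N) * ℓ ^ (-(s : ℝ))) =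
                      (((N : ℝ) + 4) * (C71 N : ℝ)) * (CP * E * ℓ⁻¹ ^ N) * ((b' - a') * ℓ ^ (-(s : ℝ))) := by ring
                  rw [e]
                  have : 0 ≤ (((N : ℝ) + 4) * (C71 N : ℝ)) * (CP * E * ℓ⁻¹ ^ N) := by positivity
                  calc (((N : ℝ) + 4) * (C71 N : ℝ)) * (CP * E * ℓ⁻¹ ^ N) * ((b' - a') * ℓ ^ (-(s : ℝ)))
                      ≤ (((N : ℝ) + 4) * (C71 N : ℝ)) * (CP * E * ℓ⁻¹ ^ N) * 2 := mul_le_mul_of_nonneg_left hP this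
                    _ = 2 * (((N : ℝ) + 4) * (C71 N : ℝ)) * (CP * E * ℓ⁻¹ ^ N) := by ring
                have h3 : 2 * (((N : ℝ) + 4) * (C71 N : ℝ)) ≤ 2 * S71 := by linarith only [hS71N N hN]
                have h4 : 2 * (((N : ℝ) + 4) * (C71 N : ℝ)) * (CP * E * ℓ⁻¹ ^ N) ≤ 2 * S71 * (CP * E * ℓ⁻¹ ^ N) :=
                  mul_le_mul_of_nonneg_right h3 hY
                calc CP * E * ℓ⁻¹ ^ N + (C71 N : ℝ) * (((N : ℝ) + 4) * (CP * (b' - a') * E * ℓ⁻¹ ^ N) * ℓ ^ (-(s : ℝ)))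
                    ≤ CP * E * ℓ⁻¹ ^ N + 2 * S71 * (CP * E * ℓ⁻¹ ^ N) := by linarith only [h2, h4]
                  _ = (1 + 2 * S71) * (CP * Emax) * (δ * ℓ ^ (-(N : ℝ) + α)) := by rw [hconv25 N]; ring
                  _ ≤ C * (δ * ℓ ^ (-(N : ℝ) + α)) := by
                      refine mul_le_mul_of_nonneg_right ?_ (by positivity)
                      have key : C - (1 + 2 * S71) * (CP * Emax) = (1 + 2 * S71) * (CP * Emax) := by
                        rw [hCdef]; ring
                      have h5 : 0 ≤ (1 + 2 * S71) * (CP * Emax) := by positivity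
                      linarith only [key, h5]

end Lifespan

/-! ## `BDSV.PotentialBounds` for two consecutive exact solutions, and the gluing stage -/

section Potential

/-- **De Rosa Prop. 5.4 in the currency of the scheme** ((5.24)–(5.25): "`zᵢ - zᵢ₊₁ = z̃ᵢ - z̃ᵢ₊₁`",
so the bounds of two consecutive exact solutions on their common life span
`S_i ∩ S_{i+1} = [iτ_q, iτ_q + τ_q]` give `BDSV.PotentialBounds`): for `0 < γ < β < 1/3`,
`1 < b < (1-β)/(2β)` there is `α₀ > 0` such that for `0 < α < α₀`, every `N̄`, `(C_N)` there are
`C`, `a₀ > 1` such that for `a ≥ a₀`, `ν ∈ (0,1)`, `T > 0`, `q`, every smooth solution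
`(v_ℓ, p_ℓ, R̊_ℓ)` of the fractional NSR system on `[0,T]` with (5.6)–(5.7′) and every pair of
exact solutions `vᵢ` on `S_i`, `vᵢ₊₁` on `S_{i+1}` (`(i+1)τ_q ≤ T`) anchored to `v_ℓ` at the left
endpoints: `BDSV.PotentialBounds β α a b T C q N̄ i v_ℓ vᵢ vᵢ₊₁`.
[cite: Derosa2018, §5.2 Prop. 5.4 (5.24)–(5.25)] -/
theorem potentialBounds_of_exact :
    ∀ β : ℝ, 0 < β → β < 1 / 3 → ∀ γ : ℝ, 0 < γ → γ < β →
      ∀ b : ℝ, 1 < b → b < (1 - β) / (2 * β) →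
        ∃ α₀ : ℝ, 0 < α₀ ∧ ∀ α : ℝ, 0 < α → α < α₀ → ∀ (Nbar : ℕ) (Cin : ℕ → ℝ),
          ∃ (C a₀ : ℝ), 1 < a₀ ∧ ∀ a : ℝ, a₀ ≤ a → ∀ ν : ℝ, 0 < ν → ν < 1 → ∀ T : ℝ, 0 < T →
            ∀ (q : ℕ) (vℓ : ℝ → UnitAddTorus (Fin 3) → EuclideanSpace ℝ (Fin 3))
              (pℓ : ℝ → UnitAddTorus (Fin 3) → ℝ) (Rℓ : ℝ → UnitAddTorus (Fin 3) → Fin 3 → EuclideanSpace ℝ (Fin 3)),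
              Torus.IsFracNSReynoldsOn (Icc 0 T) γ ν vℓ pℓ Rℓ →
              (∀ N : ℕ, HolderSupLE T vℓ (N + 1) 0
                (Cin N * (Real.sqrt (amp β a b q) * freq a b q * mollScale β α a b q ^ (-(N : ℝ))))) →
              (∀ N : ℕ, HolderSupLE T Rℓ N (Real.toNNReal α)
                (Cin N * (amp β a b (q + 1) * mollScale β α a b q ^ (-(N : ℝ) + α)))) →
              ∀ (i : ℕ) (v : ℝ → UnitAddTorus (Fin 3) → EuclideanSpace ℝ (Fin 3)) (p : ℝ → UnitAddTorus (Fin 3) → ℝ)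
                (v' : ℝ → UnitAddTorus (Fin 3) → EuclideanSpace ℝ (Fin 3)) (p' : ℝ → UnitAddTorus (Fin 3) → ℝ),
                ((i + 1 : ℕ) : ℝ) * glueScale β α a b q ≤ T →
                Torus.IsFracNSReynoldsOn (glueInterval T (glueScale β α a b q) i) γ ν v p (fun _ _ _ => 0) →
                v (max ((i : ℝ) * glueScale β α a b q - glueScale β α a b q) 0) =
                  vℓ (max ((i : ℝ) * glueScale β α a b q - glueScale β α a b q) 0) →
                Torus.IsFracNSReynoldsOn (glueInterval T (glueScale β α a b q) (i + 1)) γ ν v' p' (fun _ _ _ => 0) →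
                v' (max (((i + 1 : ℕ) : ℝ) * glueScale β α a b q - glueScale β α a b q) 0) =
                  vℓ (max (((i + 1 : ℕ) : ℝ) * glueScale β α a b q - glueScale β α a b q) 0) →
                  PotentialBounds β α a b T C q Nbar i vℓ v v' := by
  intro β hβ hβ3 γ hγ hγβ b hb hb'
  obtain ⟨α₀, hα₀, hA⟩ := potential_lifespan β hβ hβ3 γ hγ hγβ b hb hb'
  refine ⟨α₀, hα₀, fun α hα hαlt Nbar Cin => ?_⟩
  obtain ⟨C, a₀, ha₀, hC⟩ := hA α hα hαlt Nbar Cin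
  refine ⟨2 * C, a₀, ha₀, fun a ha ν hν0 hν1 T hT q vℓ pℓ Rℓ hNSR h213 h214 i v p v' p' hi1T hex hanch hex' hanch' => ?_⟩
  have ha1 : 1 ≤ a := ha₀.le.trans ha
  set τ := glueScale β α a b q with hτdef
  set ℓ := mollScale β α a b q with hℓdef
  set δ := amp β a b (q + 1) with hδdef
  have hτ : 0 < τ := glueScale_pos ha1 q
  have hi0 : 0 ≤ (i : ℝ) * τ := by positivity
  have hcast : ((i + 1 : ℕ) : ℝ) * τ = (i : ℝ) * τ + τ := by push_cast; ring
  have hiT : (i : ℝ) * τ ≤ T := by rw [hcast] at hi1T; linarith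
  have hCi := hC a ha ν hν0.le hν1.le T hT q vℓ pℓ Rℓ hNSR h213 h214 i v p hiT hex hanch
  have hCi1 := hC a ha ν hν0.le hν1.le T hT q vℓ pℓ Rℓ hNSR h213 h214 (i + 1) v' p' hi1T hex' hanch'
  -- the life spans and their intersection
  set a' := max ((i : ℝ) * τ - τ) 0 with ha'
  set b' := min ((i : ℝ) * τ + τ) T with hb'def
  set a'' := max (((i + 1 : ℕ) : ℝ) * τ - τ) 0 with ha''
  set b'' := min (((i + 1 : ℕ) : ℝ) * τ + τ) T with hb''def
  have hS : glueInterval T τ i = Icc a' b' := glueInterval_eq_Icc T τ i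
  have hS' : glueInterval T τ (i + 1) = Icc a'' b'' := by
    rw [glueInterval_eq_Icc T τ (i + 1)]
  have ha''eq : a'' = (i : ℝ) * τ := by rw [ha'', hcast, add_sub_cancel_right, max_eq_left hi0]
  have hb'eq : b' = (i : ℝ) * τ + τ := by rw [hb'def, min_eq_left]; rw [hcast] at hi1T; exact hi1T
  have haa : a' ≤ a'' := by
    rw [ha''eq, ha']; exact max_le (by linarith) hi0
  have hbb : b' ≤ b'' := by
    rw [hb'def, hb''def, hcast]; exact min_le_min (by linarith) le_rfl
  have hO : glueInterval T τ i ∩ glueInterval T τ (i + 1) = Icc a'' b' := by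
    rw [hS, hS', Icc_inter_Icc, max_eq_right haa, min_eq_left hbb]
  have hlt : a'' < b' := by rw [ha''eq, hb'eq]; linarith
  have hab : a' < b' := lt_of_le_of_lt haa hlt
  have hab' : a'' < b'' := lt_of_lt_of_le hlt hbb
  have hOsub : Icc a'' b' ⊆ Icc a' b' := Icc_subset_Icc haa le_rfl
  have hOsub' : Icc a'' b' ⊆ Icc a'' b'' := Icc_subset_Icc le_rfl hbb
  have hsub : Icc a' b' ⊆ Icc 0 T := by rw [← hS]; exact glueInterval_subset_Icc T τ i
  have hsub' : Icc a'' b'' ⊆ Icc 0 T := by rw [← hS']; exact glueInterval_subset_Icc T τ (i + 1)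
  have hexI : Torus.IsFracNSReynoldsOn (Icc a' b') γ ν v p (fun _ _ _ => 0) := by rwa [hS] at hex
  have hexI' : Torus.IsFracNSReynoldsOn (Icc a'' b'') γ ν v' p' (fun _ _ _ => 0) := by rwa [hS'] at hex'
  have hℓI : Torus.IsFracNSReynoldsOn (Icc a' b') γ ν vℓ pℓ Rℓ := hNSR.mono hsub (uniqueDiffOn_Icc hab)
  have hℓI' : Torus.IsFracNSReynoldsOn (Icc a'' b'') γ ν vℓ pℓ Rℓ := hNSR.mono hsub' (uniqueDiffOn_Icc hab')
  -- the potentials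
  set z : ℝ → UnitAddTorus (Fin 3) → EuclideanSpace ℝ (Fin 3) := fun t x => BDSV.biotSavart (fun y => v t y - vℓ t y) x with hzdef
  set z' : ℝ → UnitAddTorus (Fin 3) → EuclideanSpace ℝ (Fin 3) := fun t x => BDSV.biotSavart (fun y => v' t y - vℓ t y) x with hz'def
  have hzst : FunctionSpaces.Torus.IsSmoothSpaceTimeOn (Icc a' b') z := fracPotential_smooth_Z' hab hℓI hexI (fun _ => rfl)
  have hz'st : FunctionSpaces.Torus.IsSmoothSpaceTimeOn (Icc a'' b'') z' := fracPotential_smooth_Z' hab' hℓI' hexI' (fun _ => rfl)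
  have hws : ∀ t ∈ Icc a'' b', IsSmooth (fun y => v t y - vℓ t y) := fun t ht =>
    (hexI.smooth_velocity.isSmooth_slice (hOsub ht)).sub (hℓI.smooth_velocity.isSmooth_slice (hOsub ht))
  have hws' : ∀ t ∈ Icc a'' b', IsSmooth (fun y => v' t y - vℓ t y) := fun t ht =>
    (hexI'.smooth_velocity.isSmooth_slice (hOsub' ht)).sub (hℓI'.smooth_velocity.isSmooth_slice (hOsub' ht))
  -- `ℬ(vᵢ - vᵢ₊₁) = z̃ᵢ - z̃ᵢ₊₁` on the intersection
  have hdiff : ∀ t ∈ Icc a'' b', BDSV.biotSavart (fun y => v t y - v' t y) = z t - z' t := by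
    intro t ht
    have h1 : (fun y => v t y - v' t y) = (fun y => v t y - vℓ t y) - fun y => v' t y - vℓ t y := by
      funext y; simp only [Pi.sub_apply]; abel
    rw [h1, biotSavart_sub (hws t ht) (hws' t ht)]
  refine ⟨?_, ?_⟩
  · -- (5.24)
    intro N hN t ht
    rw [hO] at ht
    have h1 := (hCi N hN t (by rw [hS]; exact hOsub ht)).1
    have h2 := (hCi1 N hN t (by rw [hS']; exact hOsub' ht)).1
    show Torus.eContDiffHolderNorm N (Real.toNNReal α) (fun x => BDSV.biotSavart (fun y => v t y - v' t y) x) ≤ _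
    rw [show (fun x => BDSV.biotSavart (fun y => v t y - v' t y) x) = BDSV.biotSavart (fun y => v t y - v' t y) from rfl, hdiff t ht]
    refine (Torus.eContDiffHolderNorm_sub_le ((isSmooth_biotSavart (hws t ht)).isContDiff (mod_cast le_top))
      ((isSmooth_biotSavart (hws' t ht)).isContDiff (mod_cast le_top))).trans ?_
    refine (add_le_add h1 h2).trans ?_
    rw [ofReal_add_self_eq]
    exact ENNReal.ofReal_le_ofReal (le_of_eq (by ring))
  · -- (5.25)
    intro N hN t ht
    rw [hO] at ht ⊢
    have h1 := (hCi N hN t (by rw [hS]; exact hOsub ht)).2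
    have h2 := (hCi1 N hN t (by rw [hS']; exact hOsub' ht)).2
    rw [hS] at h1
    rw [hS'] at h2
    have hUO : UniqueDiffOn ℝ (Icc a'' b') := uniqueDiffOn_Icc hlt
    have hzO : FunctionSpaces.Torus.IsSmoothSpaceTimeOn (Icc a'' b') z := hzst.mono hOsub
    have hz'O : FunctionSpaces.Torus.IsSmoothSpaceTimeOn (Icc a'' b') z' := hz'st.mono hOsub'
    have hzt : IsSmooth (z t) := hzO.isSmooth_slice ht
    have hz't : IsSmooth (z' t) := hz'O.isSmooth_slice ht
    -- the transport derivative within the intersection is the difference of those within the life spans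
    have key : advectiveDerivWithin (Icc a'' b') vℓ (fun t x => BDSV.biotSavart (fun y => v t y - v' t y) x) t =
        advectiveDerivWithin (Icc a' b') vℓ z t - advectiveDerivWithin (Icc a'' b'') vℓ z' t := by
      funext x
      simp only [advectiveDerivWithin, Pi.sub_apply]
      have e1 : FunctionSpaces.Torus.timeDerivWithin (Icc a'' b') (fun t x => BDSV.biotSavart (fun y => v t y - v' t y) x) t x =
          FunctionSpaces.Torus.timeDerivWithin (Icc a'' b') (fun t x => z t x - z' t x) t x := by
        unfold FunctionSpaces.Torus.timeDerivWithin
        refine derivWithin_congr (fun r hr => ?_) ?_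
        · show BDSV.biotSavart (fun y => v r y - v' r y) x = z r x - z' r x
          rw [hdiff r hr]; rfl
        · show BDSV.biotSavart (fun y => v t y - v' t y) x = z t x - z' t x
          rw [hdiff t ht]; rfl
      have e2 : FunctionSpaces.Torus.timeDerivWithin (Icc a'' b') (fun t x => z t x - z' t x) t x =
          FunctionSpaces.Torus.timeDerivWithin (Icc a'' b') z t x - FunctionSpaces.Torus.timeDerivWithin (Icc a'' b') z' t x :=
        timeDerivWithin_sub' hzO hz'O hUO ht x
      have e3 : FunctionSpaces.Torus.timeDerivWithin (Icc a'' b') z t x = FunctionSpaces.Torus.timeDerivWithin (Icc a' b') z t x :=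
        BDSV.timeDerivWithin_Icc_of_subset hlt hOsub hzst ht x
      have e4 : FunctionSpaces.Torus.timeDerivWithin (Icc a'' b') z' t x = FunctionSpaces.Torus.timeDerivWithin (Icc a'' b'') z' t x :=
        BDSV.timeDerivWithin_Icc_of_subset hlt hOsub' hz'st ht x
      have e5 : FunctionSpaces.Torus.convect (vℓ t) (fun x => BDSV.biotSavart (fun y => v t y - v' t y) x) x =
          FunctionSpaces.Torus.convect (vℓ t) (z t) x - FunctionSpaces.Torus.convect (vℓ t) (z' t) x := by
        rw [show (fun x => BDSV.biotSavart (fun y => v t y - v' t y) x) = BDSV.biotSavart (fun y => v t y - v' t y) from rfl,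
          hdiff t ht, convect_sub_right (hzt.isContDiff (by simp)) (hz't.isContDiff (by simp))]
      rw [e1, e2, e3, e4, e5]
      abel
    rw [key]
    have hs1 : IsSmooth (advectiveDerivWithin (Icc a' b') vℓ z t) := by
      have hA : IsSmooth (FunctionSpaces.Torus.timeDerivWithin (Icc a' b') z t) :=
        (hzst.timeDerivWithin (uniqueDiffOn_Icc hab)).isSmooth_slice (hOsub ht)
      have hB : IsSmooth (FunctionSpaces.Torus.convect (vℓ t) (z t)) := (hℓI.smooth_velocity.isSmooth_slice (hOsub ht)).convect hzt
      exact hA.add hB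
    have hs2 : IsSmooth (advectiveDerivWithin (Icc a'' b'') vℓ z' t) := by
      have hA : IsSmooth (FunctionSpaces.Torus.timeDerivWithin (Icc a'' b'') z' t) :=
        (hz'st.timeDerivWithin (uniqueDiffOn_Icc hab')).isSmooth_slice (hOsub' ht)
      have hB : IsSmooth (FunctionSpaces.Torus.convect (vℓ t) (z' t)) := (hℓI'.smooth_velocity.isSmooth_slice (hOsub' ht)).convect hz't
      exact hA.add hB
    refine (Torus.eContDiffHolderNorm_sub_le (hs1.isContDiff (mod_cast le_top)) (hs2.isContDiff (mod_cast le_top))).trans ?_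
    refine (add_le_add h1 h2).trans ?_
    rw [ofReal_add_self_eq]
    exact ENNReal.ofReal_le_ofReal (le_of_eq (by ring))

/-- **De Rosa's gluing stage from the local existence theory and the commutator estimate**: with
Prop. 5.4 supplied by `DeRosa.potentialBounds_of_exact`, the named fact `DeRosa.gluingStage`
follows from the existence clause of the local theory of the fractional Navier–Stokes equations
(Thm. 3.4 with Prop. 3.5 and the CFL condition (5.8)) and `BDSV.commutatorCZBound`
(BDSV App. D Prop. D.1, used for (5.17)). [cite: Derosa2018, §5.2 (Cor. 5.2, Props. 5.3–5.5)] -/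
theorem gluingStage_of_localExistence_of_commutatorCZBound
    (hloc : ∀ α : ℝ, 0 < α → α < 1 → ∀ γ : ℝ, 0 < γ → γ < 1 → ∃ c : ℝ, 0 < c ∧
      ∀ ν : ℝ, 0 < ν → ∀ (t₀ : ℝ) (u₀ : UnitAddTorus (Fin 3) → EuclideanSpace ℝ (Fin 3)),
        IsSmooth u₀ → IsDivFree u₀ → ∀ K : ℝ, 0 ≤ K →
          Torus.eContDiffHolderNorm 1 (Real.toNNReal α) u₀ ≤ ENNReal.ofReal K →
          ∀ T' : ℝ, 0 < T' → T' * K ≤ c →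
            ∃ (v : ℝ → UnitAddTorus (Fin 3) → EuclideanSpace ℝ (Fin 3)) (p : ℝ → UnitAddTorus (Fin 3) → ℝ),
              Torus.IsFracNSReynoldsOn (Icc t₀ (t₀ + T')) γ ν v p (fun _ _ _ => 0) ∧ v t₀ = u₀)
    (hcomm : commutatorCZBound) : gluingStage :=
  gluingStage_of_localExistence_of_potentialBounds_of_commutatorCZBound hloc potentialBounds_of_exact hcomm

/-- **Time translation of fractional Navier–Stokes–Reynolds triples**: the system is autonomous, so
if `(v, p, R)` solves it on `S × 𝕋³` then `t ↦ (v, p, R)(t - c)` solves it on `(S + c) × 𝕋³`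
(cf. `Torus.IsEulerReynoldsOn.timeTranslate`). [folklore] -/
theorem _root_.Literature.Analysis.FluidPDE.Torus.IsFracNSReynoldsOn.timeTranslate {S : Set ℝ} {θ ν : ℝ}
    {v : ℝ → UnitAddTorus (Fin 3) → EuclideanSpace ℝ (Fin 3)} {p : ℝ → UnitAddTorus (Fin 3) → ℝ}
    {R : ℝ → UnitAddTorus (Fin 3) → Fin 3 → EuclideanSpace ℝ (Fin 3)}
    (h : Torus.IsFracNSReynoldsOn S θ ν v p R) (c : ℝ) :
    Torus.IsFracNSReynoldsOn ((fun s : ℝ => s - c) ⁻¹' S) θ ν (fun t => v (t - c)) (fun t => p (t - c))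
      (fun t => R (t - c)) where
  smooth_velocity := h.smooth_velocity.comp_sub_time c
  smooth_pressure := h.smooth_pressure.comp_sub_time c
  smooth_stress := h.smooth_stress.comp_sub_time c
  momentum t ht x := by
    rw [Torus.timeDerivWithin_comp_sub_right]
    exact h.momentum (t - c) ht x
  divFree t ht := h.divFree (t - c) ht
  symm t ht := h.symm (t - c) ht

/-- **De Rosa's gluing stage from local existence at time `0` and the commutator estimate**: the
same as `DeRosa.gluingStage_of_localExistence_of_commutatorCZBound` with the local existence
hypothesis stated only for the initial time `t₀ = 0` (De Rosa Thm. 3.4 / Prop. 3.5 as printed: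
"Given any initial data `u₀ ∈ C^∞`, and `T ≤ c‖u₀‖_{1+α}⁻¹`, there exists a unique solution `v` of
(3.8) on `[0,T]`"), the general case following by time translation. [cite: Derosa2018, §3.2 Thm. 3.4, Prop. 3.5; §5.2] -/
theorem gluingStage_of_localExistence₀_of_commutatorCZBound
    (hloc₀ : ∀ α : ℝ, 0 < α → α < 1 → ∀ γ : ℝ, 0 < γ → γ < 1 → ∃ c : ℝ, 0 < c ∧
      ∀ ν : ℝ, 0 < ν → ∀ (u₀ : UnitAddTorus (Fin 3) → EuclideanSpace ℝ (Fin 3)),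
        IsSmooth u₀ → IsDivFree u₀ → ∀ K : ℝ, 0 ≤ K →
          Torus.eContDiffHolderNorm 1 (Real.toNNReal α) u₀ ≤ ENNReal.ofReal K →
          ∀ T' : ℝ, 0 < T' → T' * K ≤ c →
            ∃ (v : ℝ → UnitAddTorus (Fin 3) → EuclideanSpace ℝ (Fin 3)) (p : ℝ → UnitAddTorus (Fin 3) → ℝ),
              Torus.IsFracNSReynoldsOn (Icc 0 T') γ ν v p (fun _ _ _ => 0) ∧ v 0 = u₀)
    (hcomm : commutatorCZBound) : gluingStage := by
  refine gluingStage_of_localExistence_of_commutatorCZBound (fun α hα hα1 γ hγ hγ1 => ?_) hcomm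
  obtain ⟨c, hc, h⟩ := hloc₀ α hα hα1 γ hγ hγ1
  refine ⟨c, hc, fun ν hν t₀ u₀ hu₀ hdiv K hK hKu T' hT' hTK => ?_⟩
  obtain ⟨v, p, hvp, hv0⟩ := h ν hν u₀ hu₀ hdiv K hK hKu T' hT' hTK
  refine ⟨fun t => v (t - t₀), fun t => p (t - t₀), ?_, by simp [hv0]⟩
  have hS : (fun s : ℝ => s - t₀) ⁻¹' Icc 0 T' = Icc t₀ (t₀ + T') := by
    ext s
    simp only [mem_preimage, mem_Icc]
    constructor <;> rintro ⟨h1, h2⟩ <;> constructor <;> linarith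
  have h' := hvp.timeTranslate t₀
  rw [hS] at h'
  exact h'

end Potential

end DeRosa

end Literature.Analysis.FluidPDE
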